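import Literature.NumberTheory.Rogawski1990.RankOneUnstableUnitParity      -- ★ p08 (g14): `cast_evenGluingSum_sub_oddGluingSum` (`S₀(N) − S₁(N) = (−q)^N`)
import HarnessLib

/-!
# [Rogawski1990 Lemma 4.9.3; LabesseLanglands1979 §2] (R1-CM), road «R1LL-tree», brick (G3): the DEPTH-WEIGHTED κ-bracket telescopes to
# `(−q)^N × (a constant)` — eventual constancy of `Δ_{H∕C}·Φ^κ` in the depth currency

Topic `NumberTheory/Rogawski1990`; namespace `Literature.NumberTheory.Rogawski1990`.  THEOREMS ONLY (no definition, no instance, no notation, no named fact,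
no `sorry`); pure finite-sum algebra over a commutative ring ∕ a field.  Cell `pub/hodgecm-mathlib` (D-0151), crux H413 = `stmt-HodgeConjecture-24833`, line «N6nsGerm»
stub `stub_N6nsR1LL : RankOneUnstableTransferNonsplitCM` (#159 (R1-CM)); LEAD F0P3a-plan (g10) WORD T9-8 (A) (road «R1LL-tree» opened; architect A-p16 (g27); (G3) = B-p12 (g29));
design census `F0/P3a/B-p12/g29/CENSUS-R1LL-inert-LocalClass.B-p12g29.md` §4.  HONEST LABEL: HC_CM is proved only modulo the printed citations (the 2 remaining named inputs
hLiu418, h413) until rung 0 closes; nothing printed is asserted here — this file is the ARITHMETIC of the κ-combination, independent of the lattice∕orbital-integral files.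

THE MATHEMATICS.  At an inert place, for a test function of level `m` supported in a vertex stabiliser and an elliptic regular `t` of the rank-one torus `C` with
`N = ord_w(γ₁ − γ₃) ≥ m`, the orbital integral over the class of Gram parity `e` is a DEPTH SUM (census §1–§3):
`V_e(N) = φ_m · S_e(N − m) + Σ_{i<m} [N − i ≡ e (2)] · w(N − i) · φ_i`, where `S_e(M) = Σ_{j ≤ M, j ≡ e} w(j)` is the ★ (L5) gluing sum with the inline weight
`w(0) = 1`, `w(j) = q^{j−1}(q+1)`, `φ_i` is the value of the test function at the local class of depth `i` and `φ_m` its value at the centre.  The κ-combination is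
`V_0(N) − V_1(N)`; since `S_0(M) − S_1(M) = (−q)^M` (★ `cast_evenGluingSum_sub_oddGluingSum`) it equals `φ_m·(−q)^{N−m} + Σ_{i<m} (−1)^{N−i} w(N−i) φ_i`
(`depthValue_zero_sub_depthValue_one`), i.e. `(−1)^N q^N · [ (−1)^m q^{−m} φ_m + Σ_{i<m} (−1)^i (q+1) q^{−(i+1)} φ_i ]` — so after the transfer factor's `(−1)^N q^{−N}`
(census §4: `Δ(t) = μ_w(c)⁻¹ μ_w(δ)⁻¹ (−1)^N q^{−N}` under the μ-guard) the product is INDEPENDENT of `N ≥ m`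
(`neg_pow_mul_inv_pow_mul_depthValue_sub_eq`, `…_eq_of_le_of_le`).  [Rogawski1990 §4.9 p. 56: «the techniques of [LL] … apply»; this is the counting shadow of
Labesse–Langlands' statement that `Δ·Φ^κ` extends smoothly across the singular sub-torus.]

* §1 `ite_parity_sub_ite_parity` (per-depth sign), **`depthValue_zero_sub_depthValue_one`** (the bracket in a commutative ring, `m ≤ N`).
* §2 **`neg_pow_mul_inv_pow_mul_depthValue_sub_eq`** (the normalised bracket is the `N`-free constant; field, `q ≠ 0`), **`…_eq_of_le_of_le`** (eventual constancy).

## References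
* [Rogawski1990] J. D. Rogawski, *Automorphic Representations of Unitary Groups in Three Variables*, Ann. of Math. Stud. 123 (1990): §4.9 Lemma 4.9.3, (4.9.2) p. 56.
* [LabesseLanglands1979] J.-P. Labesse, R. P. Langlands, *L-indistinguishability for SL(2)*, Canad. J. Math. 31 (1979): §2.
* [Flicker1998UnitaryFL] Y. Z. Flicker, *Elementary proof of the fundamental lemma for a unitary group*, Canad. J. Math. 50 (1998): §6 p. 95 REMARK (the weights `w(j)`).
-/

set_option autoImplicit false

namespace Literature.NumberTheory.Rogawski1990

open Finset

/-! ## §1 The κ-bracket of two depth sums -/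

section Ring

variable {K : Type*} [CommRing K]

/-- Per-depth sign: `[n ≡ 0]·x − [n ≡ 1]·x = (−1)^n · x`. [cite: Flicker1998UnitaryFL, §6 p. 95 REMARK] -/
theorem ite_parity_sub_ite_parity (n : ℕ) (x : K) :
    (if n % 2 = 0 then x else 0) - (if n % 2 = 1 then x else 0) = (-1 : K) ^ n * x := by
  rcases Nat.even_or_odd n with hn | hn
  · rw [if_pos (Nat.even_iff.1 hn), if_neg (by have := Nat.even_iff.1 hn; omega), hn.neg_one_pow]
    ring
  · rw [if_neg (by have := Nat.odd_iff.1 hn; omega), if_pos (Nat.odd_iff.1 hn), hn.neg_one_pow]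
    ring

/-- **The κ-bracket of the two depth sums telescopes** (`m ≤ N`): with `S_e(M) = Σ_{j ≤ M, j ≡ e} w(j)`, `w(0) = 1`, `w(j) = q^{j−1}(q+1)`,
`(φ_m S_0(N−m) + Σ_{i<m} [N−i ≡ 0] w(N−i) φ_i) − (φ_m S_1(N−m) + Σ_{i<m} [N−i ≡ 1] w(N−i) φ_i) = φ_m (−1)^{N−m} q^{N−m} + Σ_{i<m} (−1)^{N−i} w(N−i) φ_i`
(★ `cast_evenGluingSum_sub_oddGluingSum` for the central term). [cite: Rogawski1990, §4.9 Lemma 4.9.3 (4.9.2) p. 56] [cite: LabesseLanglands1979, §2] -/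
theorem depthValue_zero_sub_depthValue_one (q N m : ℕ) (φm : K) (φ : ℕ → K) :
    (φm * ((∑ j ∈ (range (N - m + 1)).filter (fun j => j % 2 = 0), (if j = 0 then 1 else q ^ (j - 1) * (q + 1)) : ℕ) : K) +
        ∑ i ∈ range m, (if (N - i) % 2 = 0 then (((if N - i = 0 then 1 else q ^ (N - i - 1) * (q + 1) : ℕ)) : K) * φ i else 0)) -
      (φm * ((∑ j ∈ (range (N - m + 1)).filter (fun j => j % 2 = 1), (if j = 0 then 1 else q ^ (j - 1) * (q + 1)) : ℕ) : K) +
        ∑ i ∈ range m, (if (N - i) % 2 = 1 then (((if N - i = 0 then 1 else q ^ (N - i - 1) * (q + 1) : ℕ)) : K) * φ i else 0)) =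
      φm * ((-1 : K) ^ (N - m) * (q : K) ^ (N - m)) +
        ∑ i ∈ range m, (-1 : K) ^ (N - i) * ((((if N - i = 0 then 1 else q ^ (N - i - 1) * (q + 1) : ℕ)) : K) * φ i) := by
  rw [← cast_evenGluingSum_sub_oddGluingSum (K := K) q (N - m), ← Finset.sum_congr rfl fun i _ => ite_parity_sub_ite_parity (K := K) (N - i) _,
    Finset.sum_sub_distrib]
  ring

end Ring

/-! ## §2 Normalising by the transfer factor's `(−1)^N q^{−N}`: the result does not depend on `N` -/

section Field

variable {K : Type*} [Field K]

/-- **The normalised κ-bracket is `N`-free** (`m ≤ N`, `q ≠ 0` in `K`):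
`(−1)^N q^{−N} · [φ_m (−1)^{N−m} q^{N−m} + Σ_{i<m} (−1)^{N−i} w(N−i) φ_i] = (−1)^m q^{−m} φ_m + Σ_{i<m} (−1)^i (q+1) q^{−(i+1)} φ_i` — for `i < m ≤ N` the weight is
`w(N−i) = q^{N−i−1}(q+1)`. [cite: Rogawski1990, §4.9 Lemma 4.9.3 (4.9.2) p. 56] [cite: LabesseLanglands1979, §2] -/
theorem neg_pow_mul_inv_pow_mul_depthValue_sub_eq {q : ℕ} (hq : (q : K) ≠ 0) {N m : ℕ} (hmN : m ≤ N) (φm : K) (φ : ℕ → K) :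
    (-1 : K) ^ N * ((q : K) ^ N)⁻¹ *
        (φm * ((-1 : K) ^ (N - m) * (q : K) ^ (N - m)) +
          ∑ i ∈ range m, (-1 : K) ^ (N - i) * ((((if N - i = 0 then 1 else q ^ (N - i - 1) * (q + 1) : ℕ)) : K) * φ i)) =
      (-1 : K) ^ m * ((q : K) ^ m)⁻¹ * φm + ∑ i ∈ range m, (-1 : K) ^ i * (q + 1) * ((q : K) ^ (i + 1))⁻¹ * φ i := by
  have hq' : ∀ n : ℕ, ((q : K) ^ n) ≠ 0 := fun n => pow_ne_zero n hq
  have hsq : ∀ n : ℕ, (-1 : K) ^ n * (-1 : K) ^ n = 1 := fun n => by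
    rw [← pow_add, ← two_mul, pow_mul, neg_one_sq, one_pow]
  -- the central term
  have hc : (-1 : K) ^ N * ((q : K) ^ N)⁻¹ * (φm * ((-1 : K) ^ (N - m) * (q : K) ^ (N - m))) = (-1 : K) ^ m * ((q : K) ^ m)⁻¹ * φm := by
    have h1 : (-1 : K) ^ N = (-1 : K) ^ (N - m) * (-1 : K) ^ m := by rw [← pow_add, Nat.sub_add_cancel hmN]
    have h2 : (q : K) ^ N = (q : K) ^ (N - m) * (q : K) ^ m := by rw [← pow_add, Nat.sub_add_cancel hmN]
    have e2 : (q : K) ^ (N - m) * ((q : K) ^ (N - m))⁻¹ = 1 := mul_inv_cancel₀ (hq' _)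
    rw [h1, h2, mul_inv]
    linear_combination ((-1 : K) ^ m * ((q : K) ^ m)⁻¹ * φm * ((q : K) ^ (N - m) * ((q : K) ^ (N - m))⁻¹)) * hsq (N - m) +
      ((-1 : K) ^ m * ((q : K) ^ m)⁻¹ * φm) * e2
  -- the depth terms, one by one
  have hd : ∀ i ∈ range m, (-1 : K) ^ N * ((q : K) ^ N)⁻¹ *
      ((-1 : K) ^ (N - i) * ((((if N - i = 0 then 1 else q ^ (N - i - 1) * (q + 1) : ℕ)) : K) * φ i)) =
      (-1 : K) ^ i * (q + 1) * ((q : K) ^ (i + 1))⁻¹ * φ i := by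
    intro i hi
    have him : i < m := Finset.mem_range.1 hi
    have hne : N - i ≠ 0 := by omega
    rw [if_neg hne]
    have h1 : (-1 : K) ^ N = (-1 : K) ^ (N - i) * (-1 : K) ^ i := by rw [← pow_add]; congr 1; omega
    have h2 : (q : K) ^ N = (q : K) ^ (N - i - 1) * (q : K) ^ (i + 1) := by rw [← pow_add]; congr 1; omega
    have e2 : (q : K) ^ (N - i - 1) * ((q : K) ^ (N - i - 1))⁻¹ = 1 := mul_inv_cancel₀ (hq' _)
    rw [h1, h2, mul_inv]
    push_cast
    linear_combination ((-1 : K) ^ i * ((q : K) + 1) * ((q : K) ^ (i + 1))⁻¹ * φ i * ((q : K) ^ (N - i - 1) * ((q : K) ^ (N - i - 1))⁻¹)) * hsq (N - i) +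
      ((-1 : K) ^ i * ((q : K) + 1) * ((q : K) ^ (i + 1))⁻¹ * φ i) * e2
  rw [mul_add, Finset.mul_sum, hc, Finset.sum_congr rfl hd]

/-- **Eventual constancy**: for `m ≤ N` and `m ≤ N′` the normalised κ-brackets at `N` and `N′` AGREE — the counting form of «`Δ_{H∕C}(t)·Φ^κ(t, f)` extends to a locally
constant function across the `H`-singular sub-torus of `C`». [cite: Rogawski1990, §4.9 Lemma 4.9.3 (4.9.2) p. 56] [cite: LabesseLanglands1979, §2] -/
theorem neg_pow_mul_inv_pow_mul_depthValue_sub_eq_of_le_of_le {q : ℕ} (hq : (q : K) ≠ 0) {N N' m : ℕ} (hmN : m ≤ N) (hmN' : m ≤ N')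
    (φm : K) (φ : ℕ → K) :
    (-1 : K) ^ N * ((q : K) ^ N)⁻¹ *
        (φm * ((-1 : K) ^ (N - m) * (q : K) ^ (N - m)) +
          ∑ i ∈ range m, (-1 : K) ^ (N - i) * ((((if N - i = 0 then 1 else q ^ (N - i - 1) * (q + 1) : ℕ)) : K) * φ i)) =
      (-1 : K) ^ N' * ((q : K) ^ N')⁻¹ *
        (φm * ((-1 : K) ^ (N' - m) * (q : K) ^ (N' - m)) +
          ∑ i ∈ range m, (-1 : K) ^ (N' - i) * ((((if N' - i = 0 then 1 else q ^ (N' - i - 1) * (q + 1) : ℕ)) : K) * φ i)) := by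
  rw [neg_pow_mul_inv_pow_mul_depthValue_sub_eq hq hmN, neg_pow_mul_inv_pow_mul_depthValue_sub_eq hq hmN']

end Field

end Literature.NumberTheory.Rogawski1990
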